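import Summits.AtomisticToContinuum.HydrodynamicLimit.Theorems.JParityClosureRateFloorPairFunctionalTermsRung0
import Literature.MathematicalPhysics.KineticTheory.HardSphereUniformGasShift
import Literature.MathematicalPhysics.KineticTheory.HardSphereBBGKYLiouvilleFlow
import HarnessLib

/-!
# The B-side of `RateFloor` at rung 0, V-a: base-point uniformity, energy bound and `G`-integrability of the pair functional of a
# GENERAL nonnegative mark (helper file, `--supports stmt-AtomisticToContinuum-13080`)

Crux `JParityClosure.RateFloor` (stmt-AtomisticToContinuum-13080), line `Sketch`, rung-0 stub `stub_staticOpacityFloorRung0`: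
* `integral_sq_empDensity_sub_one_eq` — the position variance `V_N(x₀) = E_P(ρ̃_r(·,x₀) − 1)²` does not depend on `x₀` (translation
  invariance of `P_N`, `integral_posGibbsMeasure_add_const`), so the four-term bound of file IV is uniform in the base point;
* `pairFunctional_le_energy` — `B_r Ξ (z, x₀) ≤ M²C|S²|(1/2 + 2(N+1)⁻¹Σ‖vᵢ‖²)`; `integrable_pairFunctional_rung0`,
  `integrable_abs_pairFunctional_sub_rung0` — `G`-integrability for every continuous `0 ≤ Ξ ≤ C`;
* `pairFunctional_flow_le_of_mem_good` — boundedness along good orbits (energy conservation `HardSphereFlow.configEnergy_flow`).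
-/

noncomputable section

open MeasureTheory ProbabilityTheory Set Filter Topology
open scoped ENNReal InnerProductSpace BigOperators

namespace Summit.AtomisticToContinuum.HydrodynamicLimit.Theorems

namespace RateFloorPairFunctionalUpper

open Literature.Analysis.FluidPDE Literature.MathematicalPhysics.KineticTheory
open Literature.Probability.Moments
open Summit.AtomisticToContinuum.HydrodynamicLimit.Theorems.EvenStressEnskog

/-! ## Uniformity in the base point: translation invariance of the position variance -/

/-- The cone kernel is invariant under the diagonal torus shift. [folklore] -/
theorem coneKernel_add_const (r : ℝ) (y x₀ c : T3) : coneKernel r (y + c) (x₀ + c) = coneKernel r y x₀ := by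
  unfold coneKernel
  rw [show y + c = c + y from add_comm _ _, show x₀ + c = c + x₀ from add_comm _ _, euclidDist_add_left]

/-- The mollified empirical density read at `x₀` is that of the shifted positions read at `x₀ + c`. [folklore] -/
theorem empDensity_add_const {n : ℕ} (r : ℝ) (xs : Fin n → T3) (x₀ c : T3) :
    empDensity r (xs + fun _ => c) (x₀ + c) = empDensity r xs x₀ := by
  unfold empDensity
  simp only [Pi.add_apply, coneKernel_add_const]

/-- **The position variance does not depend on the base point**: `E_P(ρ̃_r(·, x₀) − 1)² = E_P(ρ̃_r(·, 0) − 1)²`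
(translation invariance of `P_N`, `integral_posGibbsMeasure_add_const`). [folklore] -/
theorem integral_sq_empDensity_sub_one_eq (a ε r : ℝ) (n : ℕ) (x₀ : T3) :
    ∫ xs, (empDensity r xs x₀ - 1) ^ 2 ∂posGibbsMeasure (fun _ : T3 => a) ε n =
      ∫ xs, (empDensity r xs 0 - 1) ^ 2 ∂posGibbsMeasure (fun _ : T3 => a) ε n := by
  have h := integral_posGibbsMeasure_add_const a ε n x₀ (fun xs : Fin n → T3 => (empDensity r xs x₀ - 1) ^ 2)
  rw [← h]
  refine integral_congr_ae (ae_of_all _ fun xs => ?_)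
  have e := empDensity_add_const r xs 0 x₀
  rw [zero_add] at e
  show (empDensity r (xs + fun _ => x₀) x₀ - 1) ^ 2 = (empDensity r xs 0 - 1) ^ 2
  rw [e]

/-! ## A velocity-energy bound for the pair functional; integrability under `G`; boundedness along good orbits -/

/-- **Energy bound**: for `0 ≤ Ξ ≤ C`, `r > 0`: `B_r Ξ (z, x₀) ≤ M² C |S²| (1/2 + 2 (N+1)⁻¹ Σᵢ ‖vᵢ‖²)`, `M = 3/(πr³)`
(`Θ Ξ v w ≤ C|S²|‖w − v‖ ≤ C|S²|(1/2 + ‖v‖² + ‖w‖²)`). [folklore] -/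
theorem pairFunctional_le_energy {N : ℕ} {r : ℝ} (hr : 0 < r) {Ξ : V3 × V3 × V3 → ℝ} (hΞ : Continuous Ξ)
    (hΞ0 : ∀ q, 0 ≤ Ξ q) {C : ℝ} (hΞC : ∀ q, Ξ q ≤ C) (z : Config (N + 1) (Fin 3) T3) (x₀ : T3) :
    pairFunctional r Ξ z x₀ ≤ (3 / (Real.pi * r ^ 3)) ^ 2 * (C * (sphereMeasure : Measure (Metric.sphere (0 : V3) 1)).real univ) *
      (1 / 2 + 2 * ((((N + 1 : ℕ) : ℝ))⁻¹ * ∑ i, ‖(z i).2‖ ^ 2)) := by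
  haveI := isFiniteMeasure_sphereMeasure (E := V3)
  set M : ℝ := 3 / (Real.pi * r ^ 3) with hM
  set K : ℝ := C * (sphereMeasure : Measure (Metric.sphere (0 : V3) 1)).real univ with hK
  set n : ℝ := ((N + 1 : ℕ) : ℝ) with hn
  have hn0 : 0 < n := by rw [hn]; positivity
  have hM0 : 0 ≤ M := by rw [hM]; positivity
  have hC0 : 0 ≤ C := (hΞ0 0).trans (hΞC 0)
  have hK0 : 0 ≤ K := by rw [hK]; exact mul_nonneg hC0 measureReal_nonneg
  have hb : ∀ i, 0 ≤ coneKernel r (z i).1 x₀ ∧ coneKernel r (z i).1 x₀ ≤ M := fun i => coneKernel_nonneg_le hr _ _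
  have hΘ : ∀ v w : V3, sphereMark Ξ v w ≤ K * (1 / 2 + ‖v‖ ^ 2 + ‖w‖ ^ 2) := fun v w => by
    have h1 := sphereMark_le_mul_norm hΞ hΞ0 hΞC v w
    have h2 : ‖w - v‖ ≤ 1 / 2 + ‖v‖ ^ 2 + ‖w‖ ^ 2 := by
      nlinarith [norm_sub_le w v, norm_nonneg (w - v), norm_nonneg v, norm_nonneg w, sq_nonneg (‖w - v‖ - 1),
        sq_nonneg (‖v‖ - ‖w‖)]
    exact h1.trans (mul_le_mul_of_nonneg_left h2 hK0)
  have hterm : ∀ i j, coneKernel r (z i).1 x₀ * coneKernel r (z j).1 x₀ * sphereMark Ξ (z i).2 (z j).2 ≤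
      M * M * (K * (1 / 2 + ‖(z i).2‖ ^ 2 + ‖(z j).2‖ ^ 2)) := fun i j =>
    mul_le_mul (mul_le_mul (hb i).2 (hb j).2 (hb j).1 hM0) (hΘ _ _) (sphereMark_nonneg' hΞ0 _ _) (mul_nonneg hM0 hM0)
  rw [pairFunctional_eq_sum]
  have hsum : ∑ i, ∑ j, coneKernel r (z i).1 x₀ * coneKernel r (z j).1 x₀ * sphereMark Ξ (z i).2 (z j).2 ≤
      ∑ i, ∑ j, M * M * (K * (1 / 2 + ‖(z i).2‖ ^ 2 + ‖(z j).2‖ ^ 2)) :=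
    Finset.sum_le_sum fun i _ => Finset.sum_le_sum fun j _ => hterm i j
  have hid : ∑ i : Fin (N + 1), ∑ j : Fin (N + 1), M * M * (K * (1 / 2 + ‖(z i).2‖ ^ 2 + ‖(z j).2‖ ^ 2)) =
      M * M * K * (n * n * (1 / 2) + 2 * n * ∑ i, ‖(z i).2‖ ^ 2) := by
    simp only [Finset.sum_add_distrib, Finset.sum_const, Finset.card_univ, Fintype.card_fin, nsmul_eq_mul, ← Finset.mul_sum,
      mul_add, hn]
    ring
  calc (((N + 1 : ℕ) : ℝ))⁻¹ * (((N + 1 : ℕ) : ℝ))⁻¹ * ∑ i, ∑ j, coneKernel r (z i).1 x₀ * coneKernel r (z j).1 x₀ *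
        sphereMark Ξ (z i).2 (z j).2
      ≤ n⁻¹ * n⁻¹ * (M * M * K * (n * n * (1 / 2) + 2 * n * ∑ i, ‖(z i).2‖ ^ 2)) := by
        rw [← hid]; exact mul_le_mul_of_nonneg_left hsum (by positivity)
    _ = M ^ 2 * K * (1 / 2 + 2 * (n⁻¹ * ∑ i, ‖(z i).2‖ ^ 2)) := by field_simp

/-- The velocity moment `(N+1)⁻¹ Σᵢ ‖vᵢ‖²` (times a constant, plus a constant) is `G`-integrable at rung 0. [folklore] -/
theorem integrable_const_add_mul_avg_norm_sq {σ a θ : ℝ} {u : V3} (hσ2 : σ ≤ 1 / 2) (ha : 0 < a) (hθ : 0 < θ) (N : ℕ)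
    (Φ : HardSphereFlow (Torus.geometry (Fin 3)) (hsDiameter σ N) (N + 1)) (c₀ c₁ : ℝ) :
    Integrable (fun z : Config (N + 1) (Fin 3) T3 => c₀ + c₁ * ((((N + 1 : ℕ) : ℝ))⁻¹ * ∑ i, ‖(z i).2‖ ^ 2))
      (localGibbsLaw σ (fun _ => a) (fun _ => u) (fun _ => θ) N Φ) := by
  haveI : IsProbabilityMeasure (localGibbsLaw σ (fun _ => a) (fun _ => u) (fun _ => θ) N Φ) :=
    isProbabilityMeasure_localGibbsLaw continuous_const continuous_const continuous_const (fun _ => ha) (fun _ => hθ) hσ2 N Φ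
  haveI : IsProbabilityMeasure (posGibbsMeasure (fun _ : T3 => a) (hsDiameter σ N) (N + 1)) :=
    isProbabilityMeasure_posGibbsMeasure continuous_const (fun _ => ha) hσ2 N
  refine (integrable_const c₀).add ?_
  rw [integrable_localGibbsLaw_const_iff σ ha.le hθ u N Φ]
  have hΓi : Integrable (fun vs : Fin (N + 1) → V3 => c₁ * ((((N + 1 : ℕ) : ℝ))⁻¹ * ∑ i, ‖vs i‖ ^ 2))
      (Measure.pi fun _ : Fin (N + 1) => gaussMeasure u θ) := by
    refine ((integrable_finsetSum _ fun i _ => ?_).const_mul _).const_mul _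
    have hmp := measurePreserving_eval (fun _ : Fin (N + 1) => gaussMeasure u θ) i
    exact (hmp.integrable_comp (continuous_norm.pow 2).aestronglyMeasurable).2 (integrable_norm_sq_gaussMeasure u θ)
  have h := hΓi.comp_snd (posGibbsMeasure (fun _ : T3 => a) (hsDiameter σ N) (N + 1))
  refine h.congr (ae_of_all _ fun p => ?_)
  simp only [zipConfig_apply]

/-- **The pair functional of a general continuous mark `0 ≤ Ξ ≤ C` is `G`-integrable at rung 0** (dominated by the velocity
energy, `pairFunctional_le_energy`). [folklore] -/
theorem integrable_pairFunctional_rung0 {σ a θ : ℝ} {u : V3} (hσ2 : σ ≤ 1 / 2) (ha : 0 < a) (hθ : 0 < θ)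
    {Ξ : V3 × V3 × V3 → ℝ} (hΞc : Continuous Ξ) (hΞ0 : ∀ q, 0 ≤ Ξ q) {C : ℝ} (hΞC : ∀ q, Ξ q ≤ C)
    {r : ℝ} (hr : 0 < r) (x₀ : T3) (N : ℕ) (Φ : HardSphereFlow (Torus.geometry (Fin 3)) (hsDiameter σ N) (N + 1)) :
    Integrable (fun z => pairFunctional r Ξ z x₀) (localGibbsLaw σ (fun _ => a) (fun _ => u) (fun _ => θ) N Φ) := by
  set K₁ : ℝ := (3 / (Real.pi * r ^ 3)) ^ 2 * (C * (sphereMeasure : Measure (Metric.sphere (0 : V3) 1)).real univ) with hK₁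
  have hdom := integrable_const_add_mul_avg_norm_sq (u := u) hσ2 ha hθ N Φ (K₁ * (1 / 2)) (K₁ * 2)
  refine Integrable.mono' hdom (continuous_pairFunctional_comp r hΞc continuous_id continuous_const).measurable.aestronglyMeasurable
    (ae_of_all _ fun z => ?_)
  rw [Real.norm_eq_abs, abs_of_nonneg (pairFunctional_nonneg hr hΞ0 z x₀)]
  have h := pairFunctional_le_energy hr hΞc hΞ0 hΞC z x₀
  rw [← hK₁] at h
  linarith [h]

/-- `|B_r Ξ − c|` is `G`-integrable at rung 0. [folklore] -/
theorem integrable_abs_pairFunctional_sub_rung0 {σ a θ : ℝ} {u : V3} (hσ2 : σ ≤ 1 / 2) (ha : 0 < a) (hθ : 0 < θ)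
    {Ξ : V3 × V3 × V3 → ℝ} (hΞc : Continuous Ξ) (hΞ0 : ∀ q, 0 ≤ Ξ q) {C : ℝ} (hΞC : ∀ q, Ξ q ≤ C)
    {r : ℝ} (hr : 0 < r) (x₀ : T3) (N : ℕ) (Φ : HardSphereFlow (Torus.geometry (Fin 3)) (hsDiameter σ N) (N + 1)) (c : ℝ) :
    Integrable (fun z => |pairFunctional r Ξ z x₀ - c|) (localGibbsLaw σ (fun _ => a) (fun _ => u) (fun _ => θ) N Φ) := by
  haveI : IsProbabilityMeasure (localGibbsLaw σ (fun _ => a) (fun _ => u) (fun _ => θ) N Φ) :=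
    isProbabilityMeasure_localGibbsLaw continuous_const continuous_const continuous_const (fun _ => ha) (fun _ => hθ) hσ2 N Φ
  exact ((integrable_pairFunctional_rung0 (u := u) hσ2 ha hθ hΞc hΞ0 hΞC hr x₀ N Φ).sub (integrable_const c)).abs

/-- **Along a good orbit the pair functional is bounded, uniformly in time and base point** (energy conservation
`HardSphereFlow.configEnergy_flow`): `B_r Ξ (Φ_s z, x₀) ≤ M²C|S²| (1/2 + 4 E(z)/(N+1))`. [folklore] -/
theorem pairFunctional_flow_le_of_mem_good {N : ℕ} {ε r : ℝ} (hr : 0 < r) {Ξ : V3 × V3 × V3 → ℝ} (hΞ : Continuous Ξ)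
    (hΞ0 : ∀ q, 0 ≤ Ξ q) {C : ℝ} (hΞC : ∀ q, Ξ q ≤ C) (Φ : HardSphereFlow (Torus.geometry (Fin 3)) ε (N + 1))
    {z : Config (N + 1) (Fin 3) T3} (hz : z ∈ Φ.good) (s : ℝ) (x₀ : T3) :
    pairFunctional r Ξ (Φ.flow s z) x₀ ≤ (3 / (Real.pi * r ^ 3)) ^ 2 *
      (C * (sphereMeasure : Measure (Metric.sphere (0 : V3) 1)).real univ) *
        (1 / 2 + 4 * ((((N + 1 : ℕ) : ℝ))⁻¹ * configEnergy z)) := by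
  have h := pairFunctional_le_energy hr hΞ hΞ0 hΞC (Φ.flow s z) x₀
  have hE : (((N + 1 : ℕ) : ℝ))⁻¹ * ∑ i, ‖(Φ.flow s z i).2‖ ^ 2 = 2 * ((((N + 1 : ℕ) : ℝ))⁻¹ * configEnergy z) := by
    rw [← Φ.configEnergy_flow hz s, configEnergy]; ring
  rw [hE] at h
  linarith [h]


/-- **Registered helper stub `stub_integrablePairFunctionalRung0`** of crux stmt-AtomisticToContinuum-13080 (line `Sketch`, input of
`stub_staticOpacityFloorRung0`), closed signature form of `integrable_pairFunctional_rung0`. [folklore] -/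
theorem stub_integrablePairFunctionalRung0 : ∀ (σ a θ : ℝ) (u : V3), σ ≤ 1 / 2 → 0 < a → 0 < θ → ∀ (Ξ : V3 × V3 × V3 → ℝ), Continuous Ξ → (∀ q, 0 ≤ Ξ q) → ∀ (C : ℝ), (∀ q, Ξ q ≤ C) → ∀ (r : ℝ), 0 < r → ∀ (x₀ : T3) (N : ℕ) (Φ : HardSphereFlow (Torus.geometry (Fin 3)) (hsDiameter σ N) (N + 1)), MeasureTheory.Integrable (fun z => pairFunctional r Ξ z x₀) (localGibbsLaw σ (fun _ => a) (fun _ => u) (fun _ => θ) N Φ) :=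
  fun _σ _a _θ u hσ2 ha hθ _Ξ hΞc hΞ0 _C hΞC _r hr x₀ N Φ =>
    integrable_pairFunctional_rung0 (u := u) hσ2 ha hθ hΞc hΞ0 hΞC hr x₀ N Φ

end RateFloorPairFunctionalUpper

end Summit.AtomisticToContinuum.HydrodynamicLimit.Theorems

end
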